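import Mathlib.RingTheory.MvPowerSeries.Basic
import Mathlib.RingTheory.MvPolynomial.Homogeneous
import Mathlib.Algebra.MvPolynomial.Basic
import Mathlib.Data.Finsupp.Lex
import Mathlib.Data.Finsupp.Weight
import Mathlib.Tactic
import HarnessLib

/-!
# The lexicographically extreme coefficient of a product (the Vandermonde dampener trick)

Calegari–Dimitrov–Tang use, for the Cauchy bound of the leading coefficient `β 𝐱^𝐧` of the
auxiliary function (arXiv:2408.15403, §6.5.3 eq. (6.21); and, in its original form,
*The unbounded denominators conjecture*, arXiv:2109.09040, §2.5.3, p. 14), the following algebraic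
mechanism: "Among the nonvanishing monomials `c 𝐱^𝐧` of minimal order `|𝐧| = β`, choose the one
whose degree vector `𝐧` has the highest lexicographical ordering. … In the factor `V(𝐳)^M` it is
`z_1^{(d−1)M} ⋯ z_{d−1}^M` that has the highest lexicographical ordering. Consequently
`c φ'(0)^β z_1^{n_1+(d−1)M} ⋯ z_d^{n_d}` exhibits a monomial in `V(𝐳)^M F(φ(𝐳))` of the minimal
order `β + M binom(d,2)`; for it has the strictly highest lexicographical ordering across all
monomials of that degree." In other words: **the coefficient of `𝐳^{𝐧+𝐞₀}` in `P·G` is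
`[𝐳^{𝐞₀}]P · [𝐳^𝐧]G`** whenever `P` is homogeneous with lexicographically highest exponent `𝐞₀`
and `𝐧` is lexicographically highest among the minimal-degree exponents of `G`. This file proves
that statement for multivariate power series (`coeff_add_mul_of_lex_extreme`).

No named facts.

## References

* [CalegariDimitrovTang2025] arXiv:2109.09040, §2.5.3 (p. 14).
* [CalegariDimitrovTang2024] arXiv:2408.15403, §6.5.3 eq. (6.21).
-/

noncomputable section

open Finset

namespace Literature.NumberTheory.Transcendental

namespace CalegariDimitrovTang

variable {σ : Type*} [LinearOrder σ] {R : Type*} [CommRing R]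

/-- **The lexicographically extreme coefficient of a product.** Let `P, G` be multivariate power
series such that every exponent `𝐞` of `P` has total degree `D` and `𝐞 ≤_lex 𝐞₀`, every
exponent `𝛎` of `G` has total degree `≥ β`, and `𝛎 ≤_lex 𝐧` whenever its degree is `β`, where
`deg 𝐧 = β`. Then `[𝐳^{𝐧+𝐞₀}](P·G) = [𝐳^{𝐞₀}]P · [𝐳^𝐧]G`.
[cite: CalegariDimitrovTang2025, §2.5.3 (p. 14); CalegariDimitrovTang2024, §6.5.3 eq. (6.21)] -/
theorem coeff_add_mul_of_lex_extreme (P G : MvPowerSeries σ R) {D β : ℕ} {e₀ n : σ →₀ ℕ}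
    (hPdeg : ∀ e, MvPowerSeries.coeff e P ≠ 0 → e.degree = D)
    (hPlex : ∀ e, MvPowerSeries.coeff e P ≠ 0 → toLex e ≤ toLex e₀)
    (hGdeg : ∀ ν, MvPowerSeries.coeff ν G ≠ 0 → β ≤ ν.degree)
    (hGlex : ∀ ν, MvPowerSeries.coeff ν G ≠ 0 → ν.degree = β → toLex ν ≤ toLex n)
    (hn : n.degree = β) (he₀ : e₀.degree = D) :
    MvPowerSeries.coeff (e₀ + n) (P * G) = MvPowerSeries.coeff e₀ P * MvPowerSeries.coeff n G := by
  classical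
  rw [MvPowerSeries.coeff_mul, Finset.sum_eq_single (e₀, n)]
  · rintro ⟨e, ν⟩ hmem hne
    rw [Finset.mem_antidiagonal] at hmem
    simp only at hmem ⊢
    by_contra hprod
    have hPe : MvPowerSeries.coeff e P ≠ 0 := fun h => hprod (by rw [h, zero_mul])
    have hGν : MvPowerSeries.coeff ν G ≠ 0 := fun h => hprod (by rw [h, mul_zero])
    -- degrees: `deg e = D`, `deg ν ≥ β`, `deg e + deg ν = D + β` ⇒ `deg ν = β`
    have hdeg : e.degree + ν.degree = D + β := by
      rw [← map_add, hmem, map_add, he₀, hn]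
    have hνdeg : ν.degree = β := by have := hPdeg e hPe; have := hGdeg ν hGν; omega
    -- lex: `e ≤ e₀`, `ν ≤ n`, `e + ν = e₀ + n` ⇒ equality
    have h1 : toLex e ≤ toLex e₀ := hPlex e hPe
    have h2 : toLex ν ≤ toLex n := hGlex ν hGν hνdeg
    have hsum : toLex e + toLex ν = toLex e₀ + toLex n := by
      rw [← toLex_add, ← toLex_add, hmem]
    have he : toLex e = toLex e₀ := by
      by_contra hne'
      have hlt : toLex e < toLex e₀ := lt_of_le_of_ne h1 hne'
      have : toLex e + toLex ν < toLex e₀ + toLex n := add_lt_add_of_lt_of_le hlt h2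
      exact absurd hsum this.ne
    have hν : toLex ν = toLex n := by
      rw [he] at hsum
      exact add_left_cancel hsum
    exact hne (Prod.ext (toLex_inj.mp he) (toLex_inj.mp hν))
  · intro h
    exfalso
    exact h (Finset.mem_antidiagonal.mpr (by simp))

/-! ### Lexicographically bounded polynomials and their products -/

/-- `P` is lex-bounded by `a`: every exponent of `P` is `≤_lex a`. [folklore] -/
def LexBounded (P : MvPolynomial σ R) (a : σ →₀ ℕ) : Prop :=
  ∀ e, MvPolynomial.coeff e P ≠ 0 → toLex e ≤ toLex a

omit [LinearOrder σ] in
/-- Products of lex-bounded polynomials are lex-bounded by the sum, with multiplicative top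
coefficients. [folklore] -/
theorem LexBounded.mul [LinearOrder σ] {P Q : MvPolynomial σ R} {a b : σ →₀ ℕ}
    (hP : LexBounded P a) (hQ : LexBounded Q b) :
    LexBounded (P * Q) (a + b) ∧
      MvPolynomial.coeff (a + b) (P * Q) = MvPolynomial.coeff a P * MvPolynomial.coeff b Q := by
  classical
  constructor
  · intro e he
    rw [MvPolynomial.coeff_mul] at he
    obtain ⟨⟨x, y⟩, hxy, hne⟩ := Finset.exists_ne_zero_of_sum_ne_zero he
    rw [Finset.mem_antidiagonal] at hxy
    have hx : MvPolynomial.coeff x P ≠ 0 := fun h => hne (by rw [h, zero_mul])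
    have hy : MvPolynomial.coeff y Q ≠ 0 := fun h => hne (by rw [h, mul_zero])
    have := add_le_add (hP x hx) (hQ y hy)
    rw [← toLex_add, ← toLex_add] at this
    simpa [hxy] using this
  · rw [MvPolynomial.coeff_mul, Finset.sum_eq_single (a, b)]
    · rintro ⟨x, y⟩ hmem hne
      rw [Finset.mem_antidiagonal] at hmem
      simp only at hmem ⊢
      by_contra hprod
      have hx : MvPolynomial.coeff x P ≠ 0 := fun h => hprod (by rw [h, zero_mul])
      have hy : MvPolynomial.coeff y Q ≠ 0 := fun h => hprod (by rw [h, mul_zero])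
      have h1 := hP x hx
      have h2 := hQ y hy
      have hsum : toLex x + toLex y = toLex a + toLex b := by rw [← toLex_add, ← toLex_add, hmem]
      have hxa : toLex x = toLex a := by
        by_contra hne'
        have : toLex x + toLex y < toLex a + toLex b := add_lt_add_of_lt_of_le (lt_of_le_of_ne h1 hne') h2
        exact absurd hsum this.ne
      have hyb : toLex y = toLex b := by
        rw [hxa] at hsum; exact add_left_cancel hsum
      exact hne (Prod.ext (toLex_inj.mp hxa) (toLex_inj.mp hyb))
    · intro h; exfalso; exact h (Finset.mem_antidiagonal.mpr (by simp))

/-- Finite products of lex-bounded polynomials. [folklore] -/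
theorem LexBounded.prod {ι : Type*} (s : Finset ι) (f : ι → MvPolynomial σ R) (a : ι → σ →₀ ℕ)
    (h : ∀ i ∈ s, LexBounded (f i) (a i)) :
    LexBounded (∏ i ∈ s, f i) (∑ i ∈ s, a i) ∧
      MvPolynomial.coeff (∑ i ∈ s, a i) (∏ i ∈ s, f i) = ∏ i ∈ s, MvPolynomial.coeff (a i) (f i) := by
  classical
  induction s using Finset.induction_on with
  | empty =>
    refine ⟨fun e he => ?_, by simp⟩
    simp only [Finset.prod_empty, MvPolynomial.coeff_one, ne_eq, ite_eq_right_iff, Classical.not_imp] at he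
    rw [Finset.sum_empty, ← he.1]
  | insert i s hi ih =>
    obtain ⟨ih1, ih2⟩ := ih fun j hj => h j (Finset.mem_insert_of_mem hj)
    have hi' := h i (Finset.mem_insert_self i s)
    obtain ⟨m1, m2⟩ := hi'.mul ih1
    rw [Finset.prod_insert hi, Finset.sum_insert hi, Finset.prod_insert hi]
    exact ⟨m1, by rw [m2, ih2]⟩

/-- Powers of a lex-bounded polynomial. [folklore] -/
theorem LexBounded.pow {P : MvPolynomial σ R} {a : σ →₀ ℕ} (hP : LexBounded P a) (M : ℕ) :
    LexBounded (P ^ M) (M • a) ∧ MvPolynomial.coeff (M • a) (P ^ M) = MvPolynomial.coeff a P ^ M := by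
  have := LexBounded.prod (Finset.range M) (fun _ => P) (fun _ => a) fun _ _ => hP
  simpa [Finset.prod_const, Finset.sum_const, Finset.card_range] using this

/-! ### The Vandermonde-type products `Π_{(i,j) ∈ S} (X_i − X_j)` -/

/-- `X_i − X_j` (`i < j`) is lex-bounded by `X_i`, with top coefficient `1`. [folklore] -/
theorem lexBounded_X_sub_X {i j : σ} (hij : i < j) :
    LexBounded (MvPolynomial.X i - MvPolynomial.X j : MvPolynomial σ R) (Finsupp.single i 1) ∧
      MvPolynomial.coeff (Finsupp.single i 1) (MvPolynomial.X i - MvPolynomial.X j : MvPolynomial σ R) = 1 := by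
  classical
  have hne : Finsupp.single j 1 ≠ (Finsupp.single i 1 : σ →₀ ℕ) := by
    intro h
    have := Finsupp.single_left_injective (one_ne_zero) h
    exact hij.ne' this
  constructor
  · intro e he
    rw [MvPolynomial.coeff_sub, MvPolynomial.coeff_X, MvPolynomial.coeff_X] at he
    by_cases h1 : Finsupp.single i 1 = e
    · rw [h1]
    · rw [if_neg h1] at he
      by_cases h2 : Finsupp.single j 1 = e
      · -- `e = X_j < X_i` in lex (first difference at `i`)
        rw [← h2]
        apply le_of_lt
        show toLex (Finsupp.single j 1) < toLex (Finsupp.single i 1)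
        rw [Finsupp.Lex.lt_iff]
        refine ⟨i, fun k hk => ?_, ?_⟩
        · show (Finsupp.single j 1) k = (Finsupp.single i 1) k
          rw [Finsupp.single_eq_of_ne (hk.trans hij).ne, Finsupp.single_eq_of_ne hk.ne]
        · show (Finsupp.single j 1) i < (Finsupp.single i 1) i
          rw [Finsupp.single_eq_of_ne hij.ne, Finsupp.single_eq_same]; exact Nat.zero_lt_one
      · rw [if_neg h2, sub_zero] at he; exact absurd rfl he
  · rw [MvPolynomial.coeff_sub, MvPolynomial.coeff_X, MvPolynomial.coeff_X, if_pos rfl, if_neg hne, sub_zero]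

/-- The generalised Vandermonde product `V_S = Π_{(i,j) ∈ S} (X_i − X_j)` over a set `S` of
pairs `i < j` (the Vandermonde polynomial for `S` = all pairs; the block dampener
`Π_k V(𝐳^{(k)})` for `S` = the pairs within blocks). [cite: CalegariDimitrovTang2024, §6.5.1–6.5.2] -/
def vprod (S : Finset (σ × σ)) : MvPolynomial σ R := ∏ p ∈ S, (MvPolynomial.X p.1 - MvPolynomial.X p.2)

/-- The lex-top exponent `ρ_S = Σ_{(i,j)∈S} 𝐞_i` of `V_S`. [folklore] -/
def vtop (S : Finset (σ × σ)) : σ →₀ ℕ := ∑ p ∈ S, Finsupp.single p.1 1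

/-- **`V_S^M` is lex-bounded by `M ρ_S` with top coefficient `1`** (UDC: "in the factor `V(𝐳)^M` it
is `z_1^{(d−1)M} ⋯ z_{d−1}^M` that has the highest lexicographical ordering").
[cite: CalegariDimitrovTang2025, §2.5.3 (p. 14)] -/
theorem lexBounded_vprod_pow (S : Finset (σ × σ)) (hS : ∀ p ∈ S, p.1 < p.2) (M : ℕ) :
    LexBounded ((vprod S : MvPolynomial σ R) ^ M) (M • vtop S) ∧
      MvPolynomial.coeff (M • vtop S) ((vprod S : MvPolynomial σ R) ^ M) = 1 := by
  have hV := LexBounded.prod S (fun p => (MvPolynomial.X p.1 - MvPolynomial.X p.2 : MvPolynomial σ R))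
    (fun p => Finsupp.single p.1 1) fun p hp => (lexBounded_X_sub_X (hS p hp)).1
  have hcoeff : MvPolynomial.coeff (vtop S) (vprod S : MvPolynomial σ R) = 1 := by
    rw [vtop, vprod, hV.2]
    exact Finset.prod_eq_one fun p hp => (lexBounded_X_sub_X (hS p hp)).2
  have hb : LexBounded (vprod S : MvPolynomial σ R) (vtop S) := hV.1
  obtain ⟨h1, h2⟩ := hb.pow M
  exact ⟨h1, by rw [h2, hcoeff, one_pow]⟩

omit [LinearOrder σ] in
/-- `V_S^M` is homogeneous of degree `M · #S`. [folklore] -/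
theorem isHomogeneous_vprod_pow (S : Finset (σ × σ)) (M : ℕ) :
    ((vprod S : MvPolynomial σ R) ^ M).IsHomogeneous (S.card * M) := by
  have h1 : (vprod S : MvPolynomial σ R).IsHomogeneous (∑ _p ∈ S, 1) :=
    MvPolynomial.IsHomogeneous.prod S _ (fun _ => 1) fun p _ =>
      (MvPolynomial.isHomogeneous_X R p.1).sub (MvPolynomial.isHomogeneous_X R p.2)
  rw [Finset.sum_const, smul_eq_mul, mul_one] at h1
  exact h1.pow M

omit [LinearOrder σ] in
/-- `deg (M ρ_S) = M #S`. [folklore] -/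
theorem degree_vtop (S : Finset (σ × σ)) (M : ℕ) : (M • vtop S).degree = S.card * M := by
  rw [map_nsmul, vtop, map_sum]
  simp [Finsupp.degree_single, mul_comm]

/-- **The dampener trick** (as used for the Cauchy bound of the leading coefficient): if `𝐧` is
lexicographically highest among the minimal-degree (`= β`) exponents of the power series `G`, then
`[𝐳^{𝐧 + Mρ_S}](V_S^M · G) = [𝐳^𝐧] G`. [cite: CalegariDimitrovTang2025, §2.5.3 (p. 14);
CalegariDimitrovTang2024, §6.5.3 eq. (6.21)] -/
theorem coeff_vprod_pow_mul (S : Finset (σ × σ)) (hS : ∀ p ∈ S, p.1 < p.2) (M : ℕ)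
    (G : MvPowerSeries σ R) {β : ℕ} {n : σ →₀ ℕ}
    (hGdeg : ∀ ν, MvPowerSeries.coeff ν G ≠ 0 → β ≤ ν.degree)
    (hGlex : ∀ ν, MvPowerSeries.coeff ν G ≠ 0 → ν.degree = β → toLex ν ≤ toLex n)
    (hn : n.degree = β) :
    MvPowerSeries.coeff (M • vtop S + n) ((((vprod S : MvPolynomial σ R) ^ M : MvPolynomial σ R) :
      MvPowerSeries σ R) * G) = MvPowerSeries.coeff n G := by
  obtain ⟨hlex, htop⟩ := lexBounded_vprod_pow (R := R) S hS M
  have hhom := isHomogeneous_vprod_pow (R := R) S M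
  have key := coeff_add_mul_of_lex_extreme
    (((vprod S : MvPolynomial σ R) ^ M : MvPolynomial σ R) : MvPowerSeries σ R) G
    (D := S.card * M) (β := β) (e₀ := M • vtop S) (n := n)
    (fun e he => by
      rw [MvPolynomial.coeff_coe] at he
      by_contra hd
      exact he (hhom.coeff_eq_zero hd))
    (fun e he => by rw [MvPolynomial.coeff_coe] at he; exact hlex e he)
    hGdeg hGlex hn (degree_vtop S M)
  rw [key, MvPolynomial.coeff_coe, htop, one_mul]

end CalegariDimitrovTang

end Literature.NumberTheory.Transcendental
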